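import Summits.ABC.IUTFork.Repair.CandInternal11Gap
import Summits.ABC.IUTFork.Repair.CandMochizuki4
import Summits.ABC.IUTFork.Repair.CandMochizuki6
import Summits.ABC.IUTFork.Repair.CandExplicit1
import HarnessLib

/-!
# IUT REPAIR BRANCH (rung LADDER-ABC:A2.RP), seat rp-d2 — `CandInternal11Hull`: the HULL-LEVEL rows of record across classes — RP-M04b
# (`CandMochizuki4.H'`, Rmk 3.11.1 (iii) (SHE)/(APT) at hull level), RP-M36b = RP-M05b (`CandMochizuki6.H'`, Rmk 3.12.2 (v) «hull absorbs
# the saturation» with an ABSTRACT saturation), RP-X01b (`CandExplicit1.H_Englf`, [EssLgc] at hull level) — are, inside print's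
# (Ind3)-as-containers reading (RP-I05 ∧ RP-I05c), the log-shell comparison RP-I06 / RP-I06⋆; and the log-shell saturation of class (i)
# INSTANTIATES rp-m2's abstract saturation row

Proof-only cross-reference file (D-0012; one bookkeeping saturation `satOfShell`, no `Prop` fact) of the abc-iut cell, IUT REPAIR branch
(REPAIR-SPEC v0.4; abc-iut-rp-plan RULINGS #20 «M32c ≡ I06 on print's container reading — the §J sentence will say exactly that»; this file
extends the sentence to the other hull-level rows of record). TAKES NO SIDE on [IUTchIII] Cor. 3.12 or on any author; candidates stay
hypotheses; typed ≠ proved; standard axioms. Imports BY NAME: abc-iut-rp-m2's `CandMochizuki4` (M04b `H'`, `H'_iff_gapH3`) and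
`CandMochizuki6` (M36: `Saturation`, `Extensive`, `HullAbsorbs`, `QInSaturatedImage`, `H'`, `exists_H'_iff_gapH3`), abc-iut-rp-x1's
`CandExplicit1` (X01b `H_Englf`, `H_Englf_iff`), this seat's `CandInternal11`/`CandInternal11Gap` (RP-I05c container bound,
`hull_iff_hQShellOrbit`, `gapH3_iff_star`) and `CandInternal2` (RP-I05 `HInd3Hull`, RP-I06 `HQShellOrbit`, `shellSat`).

RESULTS (general frozen vocabulary): (1) `m04b_iff_star` — under `PinnedRegions`, RP-I05, RP-I05c: `CandMochizuki4.H' ↔ (LinkPinned → RP-I06⋆)`;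
with the three pins `CandMochizuki4.H' ↔ RP-I06⋆`. (2) `x01b_iff_hQShellOrbit` — under the link pin, RP-I05, RP-I05c: `CandExplicit1.H_Englf ↔
RP-I06`. (3) THE INSTANCE: `satOfShell` := «U ↦ U ∪ (log-shell orbit of the Θ-data)» is a `CandMochizuki6.Saturation` with `Extensive` and —
given RP-I05 — `HullAbsorbs`; RP-I06⋆ gives `QInSaturatedImage`; hence **`m36b_of_I05_star : HInd3Hull → HQShellOrbitStar → CandMochizuki6.H'
… satOfShell`** (class (i)'s log-shell pair IS an instance of class (ii)'s abstract «hull absorbs the saturation ∧ q in a saturated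
image» row, at the TYPED (Ind3) log-shell), and conversely under the three pins + RP-I05 + RP-I05c **`exists_m36b_iff_star :
(∃ sat, CandMochizuki6.H' … sat) ↔ HQShellOrbitStar`**. READING for §J (neutral): every hull-level row of record (M32c — `CandInternal11M32c`
—, M04b, M36b, X01b) is, inside print's own containers reading, ONE hypothesis: the local height condition «q_v·𝒪 ⊆ q_v^{j²}·𝓘_v» of RP-I06,
graded NOT-IN-PRINT-as-premise. [claim: Mochizuki2012, status: disputed] [cite: ScholzeStix2018, §2.2 pp. 9–10]
-/

noncomputable section

open Set

namespace Summit.ABC.IUTFork.Repair.CandInternal11Hull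

open Thm311 Cor312 Cor312Vol Literature.IUT.LogThetaLattice Summit.ABC.IUTFork.Repair.CandInternal2
  Summit.ABC.IUTFork.Repair.CandInternal11Gap

variable {T : ThetaIndex} (S : LatticeSituation T) (P : Cor312.Setting S.toSituation)
  (ρ : (∀ v : T.V, v ∈ T.Vbad → Set (S.L.StarPacket v)) → ∀ (j : T.Label) (vQ : T.VQ), Set (S.L.Packet j vQ))
  (qK : ∀ v : T.V, v ∈ T.Vbad → Set (S.L.StarPacket v))

/-! ## 1. RP-M04b and RP-X01b in the containers reading -/

/-- **RP-M04b ≡ (link pin → RP-I06⋆)** under the two region pins, RP-I05 and RP-I05c (via `CandMochizuki4.H'_iff_gapH3` and `gapH3_iff_star`).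
[claim: Mochizuki2012, status: disputed] -/
theorem m04b_iff_star (hpin : PinnedRegions S P ρ qK) (hA : HInd3Hull S P ρ) (hc : CandInternal11.H S P ρ) :
    CandMochizuki4.H' S P ρ qK ↔ (LinkPinned S P → HQShellOrbitStar S P ρ qK) := by
  rw [CandMochizuki4.H'_iff_gapH3 S P ρ qK hpin, gapH3_iff_star S P ρ qK hA hc]
  exact ⟨fun h hL => h ⟨hpin, hL⟩, fun h hpin3 => h hpin3.2⟩

/-- … and with all three pins, **RP-M04b ≡ RP-I06⋆**. [claim: Mochizuki2012, status: disputed] -/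
theorem m04b_iff_star_of_pinned3 (hpin : PinnedRegions3 S P ρ qK) (hA : HInd3Hull S P ρ) (hc : CandInternal11.H S P ρ) :
    CandMochizuki4.H' S P ρ qK ↔ HQShellOrbitStar S P ρ qK := by
  rw [m04b_iff_star S P ρ qK hpin.1 hA hc]
  exact ⟨fun h => h hpin.2, fun h _ => h⟩

/-- **RP-X01b ≡ RP-I06** under the link pin, RP-I05 and RP-I05c (via `CandExplicit1.H_Englf_iff` and `hull_iff_hQShellOrbit`).
[claim: Mochizuki2012, status: disputed] -/
theorem x01b_iff_hQShellOrbit (hL : LinkPinned S P) (hA : HInd3Hull S P ρ) (hc : CandInternal11.H S P ρ) :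
    CandExplicit1.H_Englf S P ρ qK ↔ HQShellOrbit S P ρ qK := by
  rw [CandExplicit1.H_Englf_iff S P ρ qK hL, CandInternal11.hull_iff_hQShellOrbit S P ρ qK hA hc]

/-! ## 2. The typed log-shell saturation INSTANTIATES rp-m2's abstract saturation row RP-M36b -/

/-- **The region-level saturation induced by the typed (Ind3) log-shell**: `U ↦ U ∪ ⋃_m ρ(frobΨ m · 𝓘)` (enlarge by the log-shell orbit of the
Θ-pilot's Kummer data). A `CandMochizuki6.Saturation` built from frozen fields and `CandInternal2.shellSat`. Bookkeeping DATA. [claim: Mochizuki2012, status: disputed] -/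
def satOfShell : CandMochizuki6.Saturation S := fun j vQ U => U ∪ ⋃ m : ℤ, ρ (shellSat S P.n ((S.col P.n).frobΨ m)) j vQ

/-- `satOfShell` is extensive. [folklore] -/
theorem extensive_satOfShell : CandMochizuki6.Extensive S (satOfShell S P ρ) := fun _ _ _ => Set.subset_union_left

/-- **RP-I05 ⟹ `HullAbsorbs` for `satOfShell`** («the hull absorbs the log-shell saturation around every possible image»). [claim: Mochizuki2012, status: disputed] -/
theorem hullAbsorbs_satOfShell (hA : HInd3Hull S P ρ) : CandMochizuki6.HullAbsorbs S P (satOfShell S P ρ) := fun _ vQ _ hU =>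
  Set.union_subset ((Set.subset_sUnion_of_mem hU).trans ((P.frame _ vQ).subset_hull _)) (Set.iUnion_subset fun m => hA m _ vQ)

/-- **RP-I06⋆ ⟹ `QInSaturatedImage` for `satOfShell`** (the saturated possible image is the (Ind3)-enlarged region itself). [claim: Mochizuki2012, status: disputed] -/
theorem qInSaturatedImage_satOfShell (h : HQShellOrbitStar S P ρ qK) : CandMochizuki6.QInSaturatedImage S P ρ qK (satOfShell S P ρ) :=
  fun i vQ => ⟨_, P.thetaRegion3_mem_possibleImages _ vQ, (h i vQ).trans Set.subset_union_right⟩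

/-- **THE INSTANCE: RP-I05 ∧ RP-I06⋆ ⟹ RP-M36b (`CandMochizuki6.H'`) for the typed log-shell saturation** — class (i)'s log-shell pair is an
instance of class (ii)'s abstract «hull absorbs the saturation ∧ q in a saturated image». [claim: Mochizuki2012, status: disputed] -/
theorem m36b_of_I05_star (hA : HInd3Hull S P ρ) (h : HQShellOrbitStar S P ρ qK) :
    CandMochizuki6.H' S P ρ qK (satOfShell S P ρ) :=
  ⟨⟨extensive_satOfShell S P ρ, hullAbsorbs_satOfShell S P ρ hA⟩, qInSaturatedImage_satOfShell S P ρ qK h⟩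

/-- Conversely, under the three pins, RP-I05 and RP-I05c, ANY saturation satisfying RP-M36b yields RP-I06⋆ (through `GapH3`).
[claim: Mochizuki2012, status: disputed] -/
theorem star_of_exists_m36b (hpin : PinnedRegions3 S P ρ qK) (hA : HInd3Hull S P ρ) (hc : CandInternal11.H S P ρ)
    (h : ∃ sat : CandMochizuki6.Saturation S, CandMochizuki6.H' S P ρ qK sat) : HQShellOrbitStar S P ρ qK :=
  (gapH3_iff_star S P ρ qK hA hc).1 ((CandMochizuki6.exists_H'_iff_gapH3 S P ρ qK hpin).1 h) hpin

/-- **RP-M36b (∃-form) ≡ RP-I06⋆** under the three pins, RP-I05 and RP-I05c; the witness in the ← direction is the typed log-shell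
saturation `satOfShell`. [claim: Mochizuki2012, status: disputed] -/
theorem exists_m36b_iff_star (hpin : PinnedRegions3 S P ρ qK) (hA : HInd3Hull S P ρ) (hc : CandInternal11.H S P ρ) :
    (∃ sat : CandMochizuki6.Saturation S, CandMochizuki6.H' S P ρ qK sat) ↔ HQShellOrbitStar S P ρ qK :=
  ⟨star_of_exists_m36b S P ρ qK hpin hA hc, fun h => ⟨satOfShell S P ρ, m36b_of_I05_star S P ρ qK hA h⟩⟩

/-! ## 3. The hull rows, packaged: one hypothesis in the containers reading -/

/-- **Under the three pins and print's containers reading (RP-I05 ∧ RP-I05c), the hull-level rows of record M04b, M36b (∃-form) and the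
residual `GapH3` are all EQUIVALENT to RP-I06⋆**, and X01b to RP-I06 (all labels). [claim: Mochizuki2012, status: disputed] -/
theorem hull_rows_iff_star (hpin : PinnedRegions3 S P ρ qK) (hA : HInd3Hull S P ρ) (hc : CandInternal11.H S P ρ) :
    (CandMochizuki4.H' S P ρ qK ↔ HQShellOrbitStar S P ρ qK) ∧
      ((∃ sat : CandMochizuki6.Saturation S, CandMochizuki6.H' S P ρ qK sat) ↔ HQShellOrbitStar S P ρ qK) ∧
      (GapH3 S P ρ qK ↔ HQShellOrbitStar S P ρ qK) ∧
      (CandExplicit1.H_Englf S P ρ qK ↔ HQShellOrbit S P ρ qK) :=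
  ⟨m04b_iff_star_of_pinned3 S P ρ qK hpin hA hc, exists_m36b_iff_star S P ρ qK hpin hA hc,
    ⟨fun h => (gapH3_iff_star S P ρ qK hA hc).1 h hpin, fun h => (gapH3_iff_star S P ρ qK hA hc).2 fun _ => h⟩,
    x01b_iff_hQShellOrbit S P ρ qK hpin.2 hA hc⟩

end Summit.ABC.IUTFork.Repair.CandInternal11Hull

end
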